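import Literature.Computability.AlgebraicComplexity.PlethysmStability
import HarnessLib

/-!
# No hooks and no near-hooks in `Sym^d Sym^n V`: a cancellation criterion for the wreath
# symmetrisation of polytabloids, and the vanishing of plethysm highest-weight vectors

Topic `Literature/Computability/AlgebraicComplexity`, continuing `PlethysmStability.lean` (its
conventions: the word model `wordRep k N (D m)` of `V^{⊗ Dm}`, `V = k^N`, positions `Fin (D * m)`
in `D` blocks of `m` (`blockIdx`), the wreath product `S_D ≀ S_m = blockPerms D m` and its
unnormalised symmetriser `Σ = blockSymmetrizer k D m`, standard fillings `T : StdFilling (D m) Y`,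
their row words `w_T` and polytabloids `e_T = ∑_{σ ∈ C_T} sgn σ · e_{w_T ∘ σ⁻¹}`; BIP (4.1):
`Sym^D Sym^m V = (⊗^{Dm} V)^{S_D ≀ S_m}`, and BIP Prop. 3.3 / Prop. 4.5: the `S_D ≀ S_m`-invariant
highest-weight vectors of weight `λ` — the highest-weight vectors of the plethysm, counted by the
plethysm coefficient `a_λ(D[m])` — are spanned by the `Σ e_T`, `T` standard of shape `λ`).

## Results

1. **A cancellation criterion** (`StdFilling.blockSymmetrizer_polytabloid_eq_zero_of_involution`,
   `…_of_swap`): `Σ e_T = ∑_{σ ∈ C_T} sgn σ · Σ e_{w_T ∘ σ⁻¹}` and `Σ e_v` depends only on the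
   `S_D ≀ S_m`-orbit of the word `v` (`blockSymmetrizer_single_comp`); so `Σ e_T = 0` as soon as
   `C_T` carries a sign-reversing involution `σ ↦ (p q) σ` (`p ≠ q` in one column of `T`, possibly
   depending on `σ` through the other columns) such that the word `w_T ∘ σ⁻¹ ∘ (p q)` is a block
   permutation of `w_T ∘ σ⁻¹`. BIP's Lemma 4.3(1) (`p`, `q` in the same block, the transposition
   itself lying in the wreath product) is the simplest instance; the block SWAP
   (`exists_mem_blockPerms_comp_eq_comp_swap`: exchange the blocks of `p` and `q` along a bijection
   matching the remaining letters) is the instance used here.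
2. **The shapes** (`StdFilling.blockSymmetrizer_polytabloid_eq_zero_of_shape`): if the Young
   diagram `Y` (`|Y| = D m`) has all its cells outside column `0` in rows `≤ 1`, column `0` of
   length `c ≥ 2`, and second row of length `r ≤ c` with `r ≤ 1` or `c ≥ 3`, then `Σ e_T = 0` for
   EVERY standard filling `T` of `Y`. These are exactly: the hooks `(L, 1^j)`, `j ≥ 1`; the shapes
   `(L, 2, 1^j)`, `j ≥ 1`; and `(L, 3, 1^j)`, `j ≥ 1` — in particular the six "exceptional" bodies
   `λ̄ ∈ 𝔛 = {(1), (1,1), (1⁴), (1⁶), (2,1), (3,1)}` of Ikenmeyer–Panova, Adv. Math. 319 (2017),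
   Thm. 1.7(a). Proof: if two cells of column `0` sit in one block, Lemma 4.3(1); otherwise, for
   `σ ∈ C_T` call a column-`0` position *linked* if its block contains a position outside column `0`
   carrying a nonzero letter of `w_T ∘ σ⁻¹` (such letters are `1`, coming from row `1`); if two
   column-`0` positions are unlinked, swapping their letters is undone by exchanging their two
   (otherwise zero) blocks; if not, a count (`#linked ≤ #external ≤ r - 1 ≤ c - 1 ≤ #linked`) shows
   that `c ≥ 3` and that every linked block contains exactly one external letter `1`, and swapping
   the letters of two linked positions is undone by exchanging their blocks matching the two `1`s.
3. **Vanishing** (`eq_zero_of_mem_highestWeightSpace_wordRep_of_shape`,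
   `eq_zero_of_mem_highestWeightSpace_coordRep_of_shape`): hence the word model has no nonzero
   `S_D ≀ S_m`-invariant highest-weight vector of such a weight (`|S_D ≀ S_m| · x = ∑_T a_T Σ e_T`,
   BIP Prop. 3.3 in basis form, `highestWeightSpace_wordRep_eq_span_polytabloid`), and — through the
   dictionary `wordOfForm` of `PlethysmStability.lean` §5 — `k[Sym^n (k^σ)]_d` has no nonzero
   highest-weight vector of the dual weight `λ^*` for `coordRep`: the plethysm coefficient
   `a_λ(d[n])` vanishes for every `d, n` and every `λ ⊢ dn` of one of these shapes (characteristic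
   zero). For hooks this is the classical fact that `h_d[h_n]` contains no Schur function of hook
   shape other than `s_{(dn)}`; the companion file
   `Literature/Computability/Complexity/OccurrenceObstructionsIPExceptional.lean` reads off
   Ikenmeyer–Panova's Thm. 1.7(a) ("If `λ̄ ∈ 𝔛`, then `a_λ(d[n]) = 0`", there deduced from the
   finite calculation `a_{λ̄} = 0` of limit rectangular Kronecker coefficients and their Prop. 2.8)
   as a direct consequence.

## References

* P. Bürgisser, C. Ikenmeyer, G. Panova, *No occurrence obstructions in geometric complexity
  theory*, J. AMS 32 (2019) = arXiv:1604.06431v3: §3(b) Prop. 3.3, (3.5); §4 (4.1), Lemma 4.3(1),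
  Prop. 4.5. [key `BurgisserIkenmeyerPanovaJAMS2019`]
* C. Ikenmeyer, G. Panova, *Rectangular Kronecker coefficients and plethysms in geometric
  complexity theory*, Adv. Math. 319 (2017) 40–66 = arXiv:1512.03798, Thm. 1.7(a) (held text:
  Thm. 7(a)). [key `IkenmeyerPanova2017`]
* W. Fulton, *Young Tableaux*, LMS Student Texts 35 (1997), §7.2 (Lemma 2), §8.1 (polytabloids).
  [key `FultonYoungTableaux1997`]

## Mathlib and tree

Mathlib: `Finset.sum_involution`, `units_ne_neg_self`, `Equiv.swap` (`sign_swap`, `swap_mul_self`,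
`swap_apply_of_ne_of_ne`), `Function.Involutive.toPerm`, `finProdFinEquiv`, `Finset.min'`/`max'`
(`min'_lt_max'`), `Finset.card_le_card_of_injOn`, `Finset.card_image_iff`, `YoungDiagram`
(`row`, `col`, `rowLen`, `colLen`, `mem_iff_lt_rowLen`, `colLen_eq_card`). Tree
(`PlethysmStability`, `SchurWeylPlethysmHwMultiplicityProofs`, `TensorWordModel`,
`StandardFillings`): `blockSymmetrizer`, `blockSymmetrizer_wordPerm`,
`blockSymmetrizer_apply_of_forall_wordPerm_eq`, `blockPerms`, `blockIdx`,
`StdFilling.blockSymmetrizer_polytabloid_eq_zero` (Lemma 4.3(1)), `StdFilling.polytabloid`,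
`colAntisym_apply`, `colStab` API, `rowWord`, `exists_sum_smul_polytabloid_eq`,
`wordPerm_single`, `wordOfForm`, `wordOfForm_mem_highestWeightSpace`, `wordPerm_wordOfForm`,
`eq_of_wordOfForm_eq`, `ydWeight_youngDiagram`, `rowLen_youngDiagram`,
`fst_lt_of_mem_youngDiagram`. No new definitions.
-/

open scoped BigOperators

namespace Literature.Computability.AlgebraicComplexity

open Literature.NumberTheory.DiophantineGeometry (Word wordRep wordPerm wordPerm_single
  highestWeightSpace StdFilling ydWeight Weight)

/-! ### 1. Orbit sums: `Σ e_v` depends only on the wreath orbit of `v` -/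

section OrbitSum

variable (k : Type*) [CommRing k] {N D m : ℕ}

/-- `Σ e_{v ∘ β} = Σ e_v` for a block permutation `β ∈ S_D ≀ S_m`: the wreath symmetrisation of a
basis vector depends only on the `S_D ≀ S_m`-orbit of the word (`e_{v ∘ β} = β⁻¹ · e_v` and
`Σ β⁻¹ = Σ`). [cite: BurgisserIkenmeyerPanovaJAMS2019, §4 (4.1)] -/
theorem blockSymmetrizer_single_comp {β : Equiv.Perm (Fin (D * m))} (hβ : β ∈ blockPerms D m)
    (v : Word N (D * m)) :
    blockSymmetrizer k D m (Pi.single (v ∘ ⇑β) (1 : k)) = blockSymmetrizer k D m (Pi.single v 1) := by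
  have h : (Pi.single (v ∘ ⇑β) (1 : k) : Word N (D * m) → k) = wordPerm k β⁻¹ (Pi.single v 1) := by
    rw [wordPerm_single, inv_inv]
  rw [h, blockSymmetrizer_wordPerm k ((blockPerms D m).inv_mem hβ)]

end OrbitSum

/-! ### 2. The cancellation criterion -/

section Cancellation

variable {k : Type*} [Field k] {N D m : ℕ} {Y : YoungDiagram}

/-- **Cancellation by a sign-reversing involution of the column stabiliser.**
`Σ e_T = ∑_{σ ∈ C_T} sgn σ · Σ e_{w_T ∘ σ⁻¹}`; if `φ` is an involution of `C_T` reversing signs and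
such that `w_T ∘ (φ σ)⁻¹` is a block permutation of `w_T ∘ σ⁻¹` (so that both words have the same
wreath symmetrisation, `blockSymmetrizer_single_comp`), the terms of `σ` and `φ σ` cancel and
`Σ e_T = 0` (any field; `Finset.sum_involution`). BIP Lemma 4.3(1) is the case `φ σ = (p q) σ` with
`p, q` in one column AND one block. [cite: BurgisserIkenmeyerPanovaJAMS2019, Lemma 4.3 (1) (proof, generalised)] -/
theorem _root_.Literature.NumberTheory.DiophantineGeometry.StdFilling.blockSymmetrizer_polytabloid_eq_zero_of_involution
    (hN : ∀ x ∈ Y.cells, x.1 < N) (T : StdFilling (D * m) Y)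
    (φ : Equiv.Perm (Fin (D * m)) → Equiv.Perm (Fin (D * m)))
    (hφmem : ∀ σ ∈ T.colStab, φ σ ∈ T.colStab) (hφinv : ∀ σ ∈ T.colStab, φ (φ σ) = σ)
    (hφsign : ∀ σ ∈ T.colStab, Equiv.Perm.sign (φ σ) = -Equiv.Perm.sign σ)
    (hφorb : ∀ σ ∈ T.colStab, ∃ β ∈ blockPerms D m,
      T.rowWord hN ∘ ⇑(φ σ)⁻¹ = (T.rowWord hN ∘ ⇑σ⁻¹) ∘ ⇑β) :
    blockSymmetrizer k D m (T.polytabloid k hN) = 0 := by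
  rw [StdFilling.polytabloid, StdFilling.colAntisym_apply, map_sum]
  refine Finset.sum_involution (fun σ _ => φ σ) ?_ ?_ (fun σ hσ => hφmem σ hσ)
    (fun σ hσ => hφinv σ hσ)
  · intro σ hσ
    obtain ⟨β, hβ, hβeq⟩ := hφorb σ hσ
    rw [map_smul, map_smul, wordPerm_single, wordPerm_single, hβeq,
      blockSymmetrizer_single_comp k hβ, hφsign σ hσ, Units.val_neg, Int.cast_neg, neg_smul,
      add_neg_cancel]
  · intro σ hσ _ heq
    have h := hφsign σ hσ
    rw [heq] at h
    exact absurd h (units_ne_neg_self _)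

/-- **Cancellation by a transposition in a column.** If to every `σ ∈ C_T` are attached two
entries `p σ ≠ q σ` of one column of `T`, unchanged when `σ` is replaced by `(p q) σ`, such that the
word `w_T ∘ σ⁻¹ ∘ (p q)` (the letters at `p` and `q` exchanged) is a block permutation of
`w_T ∘ σ⁻¹`, then `Σ e_T = 0` (`φ σ = (p q) σ` in
`blockSymmetrizer_polytabloid_eq_zero_of_involution`). [cite: BurgisserIkenmeyerPanovaJAMS2019, Lemma 4.3 (1) (proof, generalised)] -/
theorem _root_.Literature.NumberTheory.DiophantineGeometry.StdFilling.blockSymmetrizer_polytabloid_eq_zero_of_swap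
    (hN : ∀ x ∈ Y.cells, x.1 < N) (T : StdFilling (D * m) Y)
    (p q : Equiv.Perm (Fin (D * m)) → Fin (D * m))
    (hpq : ∀ σ ∈ T.colStab, p σ ≠ q σ)
    (hcol : ∀ σ ∈ T.colStab, (T.1 (p σ)).2 = (T.1 (q σ)).2)
    (hp : ∀ σ ∈ T.colStab, p (Equiv.swap (p σ) (q σ) * σ) = p σ)
    (hq : ∀ σ ∈ T.colStab, q (Equiv.swap (p σ) (q σ) * σ) = q σ)
    (horb : ∀ σ ∈ T.colStab, ∃ β ∈ blockPerms D m,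
      (T.rowWord hN ∘ ⇑σ⁻¹) ∘ ⇑β = (T.rowWord hN ∘ ⇑σ⁻¹) ∘ ⇑(Equiv.swap (p σ) (q σ))) :
    blockSymmetrizer k D m (T.polytabloid k hN) = 0 := by
  refine T.blockSymmetrizer_polytabloid_eq_zero_of_involution hN
    (fun σ => Equiv.swap (p σ) (q σ) * σ) ?_ ?_ ?_ ?_
  · intro σ hσ
    exact StdFilling.mul_mem_colStab (StdFilling.swap_mem_colStab (hcol σ hσ)) hσ
  · intro σ hσ
    show Equiv.swap (p (Equiv.swap (p σ) (q σ) * σ)) (q (Equiv.swap (p σ) (q σ) * σ)) *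
      (Equiv.swap (p σ) (q σ) * σ) = σ
    rw [hp σ hσ, hq σ hσ, ← mul_assoc, Equiv.swap_mul_self, one_mul]
  · intro σ hσ
    show Equiv.Perm.sign (Equiv.swap (p σ) (q σ) * σ) = -Equiv.Perm.sign σ
    rw [Equiv.Perm.sign_mul, Equiv.Perm.sign_swap (hpq σ hσ), neg_mul, one_mul]
  · intro σ hσ
    obtain ⟨β, hβ, h⟩ := horb σ hσ
    refine ⟨β, hβ, ?_⟩
    show T.rowWord hN ∘ ⇑(Equiv.swap (p σ) (q σ) * σ)⁻¹ = (T.rowWord hN ∘ ⇑σ⁻¹) ∘ ⇑β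
    rw [h, mul_inv_rev, Equiv.swap_inv]
    rfl

/-- **The block swap.** Let `i ≠ j` be two blocks, `a₀` a place, `π` a permutation of the places,
and `v` a word such that the letter at place `π a` of block `j` equals the letter at place `a` of
block `i` for every `a ≠ a₀`. Then exchanging the letters of `v` at the two positions
`p = (i, a₀)` and `q = (j, π a₀)` is achieved by a block permutation `β ∈ S_D ≀ S_m` (map block `i`
to block `j` along `π`, block `j` back along `π⁻¹`): `v ∘ β = v ∘ (p q)`.
[cite: BurgisserIkenmeyerPanovaJAMS2019, §4 (the wreath product)] -/
theorem exists_mem_blockPerms_comp_eq_comp_swap {v : Word N (D * m)} {i j : Fin D} (hij : i ≠ j)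
    (a₀ : Fin m) (π : Equiv.Perm (Fin m))
    (hπ : ∀ a, a ≠ a₀ → v (finProdFinEquiv (j, π a)) = v (finProdFinEquiv (i, a))) :
    ∃ β ∈ blockPerms D m,
      v ∘ ⇑β = v ∘ ⇑(Equiv.swap (finProdFinEquiv (i, a₀)) (finProdFinEquiv (j, π a₀))) := by
  classical
  set e : Fin D × Fin m ≃ Fin (D * m) := finProdFinEquiv with he
  -- the involution of `Fin D × Fin m` exchanging the two blocks along `π`
  let Φ : Fin D × Fin m → Fin D × Fin m := fun x =>
    if x.1 = i then (j, π x.2) else if x.1 = j then (i, π.symm x.2) else x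
  have hΦi : ∀ a, Φ (i, a) = (j, π a) := fun a => by simp [Φ]
  have hΦj : ∀ a, Φ (j, a) = (i, π.symm a) := fun a => by simp [Φ, hij.symm]
  have hΦo : ∀ x : Fin D × Fin m, x.1 ≠ i → x.1 ≠ j → Φ x = x := fun x h1 h2 => by simp [Φ, h1, h2]
  have hΦ : Function.Involutive Φ := by
    rintro ⟨r, a⟩
    by_cases hri : r = i
    · subst hri; rw [hΦi, hΦj, Equiv.symm_apply_apply]
    by_cases hrj : r = j
    · subst hrj; rw [hΦj, hΦi, Equiv.apply_symm_apply]
    · rw [hΦo (r, a) hri hrj, hΦo (r, a) hri hrj]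
  have hfst : ∀ x : Fin D × Fin m, (Φ x).1 = Equiv.swap i j x.1 := by
    rintro ⟨r, a⟩
    by_cases hri : r = i
    · subst hri; rw [hΦi, Equiv.swap_apply_left]
    by_cases hrj : r = j
    · subst hrj; rw [hΦj, Equiv.swap_apply_right]
    · rw [hΦo (r, a) hri hrj, Equiv.swap_apply_of_ne_of_ne hri hrj]
  let β : Equiv.Perm (Fin (D * m)) := (e.symm.trans (hΦ.toPerm Φ)).trans e
  have hβ : ∀ x, β (e x) = e (Φ x) := fun x => by
    simp [β, Function.Involutive.coe_toPerm]
  have hblk : ∀ x : Fin D × Fin m, blockIdx D m (e x) = x.1 := by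
    rintro ⟨r, a⟩
    exact blockIdx_finProdFinEquiv r a
  refine ⟨β, ?_, ?_⟩
  · intro x y
    obtain ⟨x, rfl⟩ := e.surjective x
    obtain ⟨y, rfl⟩ := e.surjective y
    rw [hβ, hβ, hblk, hblk, hblk, hblk, hfst, hfst, (Equiv.swap i j).injective.eq_iff]
  · funext z
    obtain ⟨⟨r, a⟩, rfl⟩ := e.surjective z
    simp only [Function.comp_apply]
    rw [hβ]
    by_cases hri : r = i
    · subst hri
      rw [hΦi]
      by_cases ha : a = a₀
      · subst ha; rw [Equiv.swap_apply_left]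
      · rw [Equiv.swap_apply_of_ne_of_ne, hπ a ha]
        · intro h; exact ha (Prod.ext_iff.mp (e.injective h)).2
        · intro h; exact hij (Prod.ext_iff.mp (e.injective h)).1
    by_cases hrj : r = j
    · subst hrj
      rw [hΦj]
      by_cases ha : a = π a₀
      · subst ha; rw [Equiv.symm_apply_apply, Equiv.swap_apply_right]
      · have ha' : π.symm a ≠ a₀ := fun h => ha (by rw [← h, Equiv.apply_symm_apply])
        rw [Equiv.swap_apply_of_ne_of_ne, ← hπ _ ha', Equiv.apply_symm_apply]
        · intro h; exact hij.symm (Prod.ext_iff.mp (e.injective h)).1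
        · intro h; exact ha (Prod.ext_iff.mp (e.injective h)).2
    · rw [hΦo (r, a) hri hrj, Equiv.swap_apply_of_ne_of_ne]
      · intro h; exact hri (Prod.ext_iff.mp (e.injective h)).1
      · intro h; exact hrj (Prod.ext_iff.mp (e.injective h)).1

end Cancellation

/-! ### 3. The shapes: hooks, `(L, 2, 1^j)` and `(L, 3, 1^j)` -/

section Shapes

variable {k : Type*} [Field k] {N D m : ℕ} {Y : YoungDiagram}

/-- The entries of column `0` of a standard filling by `|Y|` entries are as many as the cells of
column `0` (a standard filling of full size is a bijection onto the cells). [folklore] -/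
theorem _root_.Literature.NumberTheory.DiophantineGeometry.StdFilling.card_filter_snd_eq_zero
    (T : StdFilling (D * m) Y) (hd : Y.cells.card = D * m) :
    (Finset.univ.filter fun x : Fin (D * m) => (T.1 x).2 = 0).card = Y.colLen 0 := by
  classical
  rw [YoungDiagram.colLen_eq_card]
  refine Finset.card_bij (fun x _ => T.1 x) ?_ ?_ ?_
  · intro x hx
    simp only [Finset.mem_filter, Finset.mem_univ, true_and] at hx
    exact YoungDiagram.mem_col_iff.mpr ⟨T.mem x, hx⟩
  · intro x _ y _ h
    exact T.injective h
  · intro c hc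
    rw [YoungDiagram.mem_col_iff] at hc
    obtain ⟨x, hx⟩ := T.exists_eq hd hc.1
    refine ⟨x, ?_, hx⟩
    simp only [Finset.mem_filter, Finset.mem_univ, true_and, hx]
    exact hc.2

/-- **External letters are few.** If all cells of `Y` outside column `0` lie in rows `≤ 1`, then
for `σ ∈ C_T` the positions outside column `0` carrying a nonzero letter of the word
`w_T ∘ σ⁻¹` (the "external" nonzero letters, necessarily equal to `1`) are at most `λ₂ - 1` in
number: they correspond injectively to the cells `(1, j)`, `1 ≤ j < λ₂`. [folklore] -/
theorem _root_.Literature.NumberTheory.DiophantineGeometry.StdFilling.card_filter_external_le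
    (T : StdFilling (D * m) Y) (h1 : ∀ c ∈ Y.cells, c.2 ≠ 0 → c.1 ≤ 1)
    {σ : Equiv.Perm (Fin (D * m))} (hσ : σ ∈ T.colStab) :
    (Finset.univ.filter fun x : Fin (D * m) =>
        (T.1 x).2 ≠ 0 ∧ (T.1 (σ⁻¹ x)).1 ≠ 0).card ≤ Y.rowLen 1 - 1 := by
  classical
  have hσ' : σ⁻¹ ∈ T.colStab := StdFilling.inv_mem_colStab hσ
  have hrow : ∀ x, (T.1 x).2 ≠ 0 → (T.1 (σ⁻¹ x)).1 ≠ 0 → (T.1 (σ⁻¹ x)).1 = 1 := by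
    intro x hx hx'
    have hc : (T.1 (σ⁻¹ x)).2 = (T.1 x).2 := StdFilling.mem_colStab.1 hσ' x
    have := h1 _ ((YoungDiagram.mem_cells _).2 (T.mem (σ⁻¹ x))) (by rw [hc]; exact hx)
    omega
  calc (Finset.univ.filter fun x : Fin (D * m) =>
          (T.1 x).2 ≠ 0 ∧ (T.1 (σ⁻¹ x)).1 ≠ 0).card ≤ (Finset.Ico 1 (Y.rowLen 1)).card := by
        refine Finset.card_le_card_of_injOn (fun x => (T.1 (σ⁻¹ x)).2) ?_ ?_
        · intro x hx
          simp only [Finset.coe_filter, Finset.mem_univ, true_and, Set.mem_setOf_eq] at hx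
          rw [Finset.coe_Ico, Set.mem_Ico]
          show 1 ≤ (T.1 (σ⁻¹ x)).2 ∧ (T.1 (σ⁻¹ x)).2 < Y.rowLen 1
          have hc : (T.1 (σ⁻¹ x)).2 = (T.1 x).2 := StdFilling.mem_colStab.1 hσ' x
          refine ⟨by rw [hc]; exact Nat.one_le_iff_ne_zero.mpr hx.1, ?_⟩
          have hmem : ((T.1 (σ⁻¹ x)).1, (T.1 (σ⁻¹ x)).2) ∈ Y := by
            rw [Prod.mk.eta]; exact T.mem _
          rw [hrow x hx.1 hx.2] at hmem
          exact YoungDiagram.mem_iff_lt_rowLen.mp hmem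
        · intro x hx y hy hxy
          simp only [Finset.coe_filter, Finset.mem_univ, true_and, Set.mem_setOf_eq] at hx hy
          have h : T.1 (σ⁻¹ x) = T.1 (σ⁻¹ y) :=
            Prod.ext (by rw [hrow x hx.1 hx.2, hrow y hy.1 hy.2]) hxy
          exact σ⁻¹.injective (T.injective h)
    _ = Y.rowLen 1 - 1 := Nat.card_Ico 1 _

variable [CharZero k]

/-- **`Σ e_T = 0` for every standard filling `T` of a hook-like shape.** Let the Young diagram `Y`
with `|Y| = D m` cells (and fewer than `N` rows) have all its cells outside column `0` in rows
`≤ 1` (`h1`), first column of length `c ≥ 2` (`h2`) and second row of length `r ≤ c` (`h3`) with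
`r ≤ 1` or `c ≥ 3` (`h4`) — i.e. `Y` is a hook `(L, 1^j)` (`j ≥ 1`) or of the form `(L, 2, 1^j)`,
`(L, 3, 1^j)` (`j ≥ 1`). Then the wreath symmetrisation of the polytabloid of every standard
filling of `Y` vanishes. If two entries of column `0` share a block this is BIP Lemma 4.3(1).
Otherwise, for `σ ∈ C_T`, call an entry of column `0` *linked* if its block contains an external
nonzero letter of `w_T ∘ σ⁻¹`. If two entries `p, q` of column `0` are unlinked, their blocks carry
no other nonzero letter and the block swap along `(a₀ c₀)` undoes the exchange of their letters;
otherwise `c - 1 ≤ #linked ≤ #externals ≤ r - 1 ≤ c - 1` forces `c ≥ 3`, `#linked ≥ 2` and exactly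
one external (a letter `1`) in each linked block, and for two linked `p, q` the block swap along a
permutation of the places with `a₀ ↦ c₀`, `a₁ ↦ c₁` (the places of the two externals) undoes the
exchange (`blockSymmetrizer_polytabloid_eq_zero_of_swap`, `exists_mem_blockPerms_comp_eq_comp_swap`).
[cite: IkenmeyerPanova2017, Thm. 1.7(a) (held: Thm. 7(a)); direct proof] -/
theorem _root_.Literature.NumberTheory.DiophantineGeometry.StdFilling.blockSymmetrizer_polytabloid_eq_zero_of_shape
    (hN : ∀ x ∈ Y.cells, x.1 < N) (hd : Y.cells.card = D * m) (T : StdFilling (D * m) Y)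
    (h1 : ∀ c ∈ Y.cells, c.2 ≠ 0 → c.1 ≤ 1) (h2 : 2 ≤ Y.colLen 0)
    (h3 : Y.rowLen 1 ≤ Y.colLen 0) (h4 : Y.rowLen 1 ≤ 1 ∨ 3 ≤ Y.colLen 0) :
    blockSymmetrizer k D m (T.polytabloid k hN) = 0 := by
  classical
  -- the entries of column `0`
  set P₀ : Finset (Fin (D * m)) := Finset.univ.filter fun x => (T.1 x).2 = 0 with hP₀
  have hP₀mem : ∀ {x}, x ∈ P₀ ↔ (T.1 x).2 = 0 := fun {x} => by simp [hP₀]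
  have hP₀card : P₀.card = Y.colLen 0 := T.card_filter_snd_eq_zero hd
  -- Case A: two entries of column `0` in one block (BIP Lemma 4.3(1))
  by_cases hA : ∃ x ∈ P₀, ∃ y ∈ P₀, x ≠ y ∧ blockIdx D m x = blockIdx D m y
  · obtain ⟨x, hx, y, hy, hxy, hb⟩ := hA
    exact T.blockSymmetrizer_polytabloid_eq_zero hN hxy ((hP₀mem.1 hx).trans (hP₀mem.1 hy).symm) hb
  push Not at hA
  -- Case B: the blocks of the entries of column `0` are pairwise distinct
  have hP₀ne : P₀.Nonempty := by rw [← Finset.card_pos, hP₀card]; omega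
  obtain ⟨x₀, -⟩ := hP₀ne
  -- externals, linked and unlinked entries of column `0`, the candidate set, as functions of `σ`
  set E : Equiv.Perm (Fin (D * m)) → Finset (Fin (D * m)) := fun σ =>
    Finset.univ.filter fun x => (T.1 x).2 ≠ 0 ∧ (T.1 (σ⁻¹ x)).1 ≠ 0 with hE
  set L : Equiv.Perm (Fin (D * m)) → Finset (Fin (D * m)) := fun σ =>
    P₀.filter fun y => ∃ x ∈ E σ, blockIdx D m x = blockIdx D m y with hL
  set U : Equiv.Perm (Fin (D * m)) → Finset (Fin (D * m)) := fun σ =>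
    P₀.filter fun y => ¬ ∃ x ∈ E σ, blockIdx D m x = blockIdx D m y with hU
  set Q : Equiv.Perm (Fin (D * m)) → Finset (Fin (D * m)) := fun σ =>
    if 1 < (U σ).card then U σ else L σ with hQ
  set pickMin : Finset (Fin (D * m)) → Fin (D * m) := fun s =>
    if h : s.Nonempty then s.min' h else x₀ with hpickMin
  set pickMax : Finset (Fin (D * m)) → Fin (D * m) := fun s =>
    if h : s.Nonempty then s.max' h else x₀ with hpickMax
  have hEmem : ∀ {σ x}, x ∈ E σ ↔ (T.1 x).2 ≠ 0 ∧ (T.1 (σ⁻¹ x)).1 ≠ 0 := fun {σ x} => by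
    simp [hE]
  have hLsub : ∀ σ, L σ ⊆ P₀ := fun σ => Finset.filter_subset _ _
  have hUsub : ∀ σ, U σ ⊆ P₀ := fun σ => Finset.filter_subset _ _
  have hQsub : ∀ σ, Q σ ⊆ P₀ := fun σ => by
    simp only [hQ]
    split_ifs
    exacts [hUsub σ, hLsub σ]
  have hUL : ∀ σ, (U σ).card + (L σ).card = Y.colLen 0 := fun σ => by
    rw [← hP₀card, add_comm]
    exact Finset.card_filter_add_card_filter_not _
  -- external letters are `1`, and few
  have hE1 : ∀ {σ}, σ ∈ T.colStab → ∀ x ∈ E σ, (T.1 (σ⁻¹ x)).1 = 1 := by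
    intro σ hσ x hx
    rw [hEmem] at hx
    have hc : (T.1 (σ⁻¹ x)).2 = (T.1 x).2 :=
      StdFilling.mem_colStab.1 (StdFilling.inv_mem_colStab hσ) x
    have := h1 _ ((YoungDiagram.mem_cells _).2 (T.mem (σ⁻¹ x))) (by rw [hc]; exact hx.1)
    omega
  have hEcard : ∀ {σ}, σ ∈ T.colStab → (E σ).card ≤ Y.rowLen 1 - 1 := fun {σ} hσ =>
    T.card_filter_external_le h1 hσ
  -- linked entries inject into the blocks of the externals
  have hLcard : ∀ σ, (L σ).card ≤ ((E σ).image (blockIdx D m)).card := by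
    intro σ
    calc (L σ).card = ((L σ).image (blockIdx D m)).card := by
          refine (Finset.card_image_of_injOn fun x hx y hy hxy => ?_).symm
          by_contra hne
          exact hA x (hLsub σ hx) y (hLsub σ hy) hne hxy
      _ ≤ ((E σ).image (blockIdx D m)).card := by
          refine Finset.card_le_card fun b hb => ?_
          rw [Finset.mem_image] at hb ⊢
          obtain ⟨y, hy, rfl⟩ := hb
          have hy' : y ∈ P₀.filter fun y => ∃ x ∈ E σ, blockIdx D m x = blockIdx D m y := hy
          rw [Finset.mem_filter] at hy'
          obtain ⟨-, x, hx, hxy⟩ := hy'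
          exact ⟨x, hx, hxy⟩
  -- a position sharing the block of an entry of column `0` lies outside column `0`
  have hG1 : ∀ {p z}, p ∈ P₀ → z ≠ p → blockIdx D m z = blockIdx D m p → (T.1 z).2 ≠ 0 := by
    intro p z hp hzp hb h0
    exact hA z (hP₀mem.2 h0) p hp hzp hb
  -- the letter of a non-external position outside column `0` is `0`
  have hG2 : ∀ {σ z}, (T.1 z).2 ≠ 0 → z ∉ E σ → (T.1 (σ⁻¹ z)).1 = 0 := by
    intro σ z hz hzE
    by_contra h
    exact hzE (hEmem.2 ⟨hz, h⟩)
  -- second case: at least two linked entries, and at most one external in each block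
  have hcase2 : ∀ {σ}, σ ∈ T.colStab → ¬ 1 < (U σ).card →
      1 < (L σ).card ∧ Set.InjOn (blockIdx D m) (E σ : Set (Fin (D * m))) := by
    intro σ hσ hU1
    have h5 := hUL σ
    have h6 := hLcard σ
    have h7 : ((E σ).image (blockIdx D m)).card ≤ (E σ).card := Finset.card_image_le
    have h8 := hEcard hσ
    have hU1' : (U σ).card ≤ 1 := not_lt.mp hU1
    refine ⟨?_, ?_⟩
    · rcases h4 with h4 | h4
      · omega
      · omega
    · rw [← Finset.card_image_iff]
      omega
  -- the candidate set has at least two elements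
  have hQcard : ∀ {σ}, σ ∈ T.colStab → 1 < (Q σ).card := by
    intro σ hσ
    simp only [hQ]
    split_ifs with h
    · exact h
    · exact (hcase2 hσ h).1
  have hpick : ∀ {s : Finset (Fin (D * m))}, 1 < s.card →
      pickMin s ∈ s ∧ pickMax s ∈ s ∧ pickMin s ≠ pickMax s := by
    intro s hs
    have hne : s.Nonempty := Finset.card_pos.mp (by omega)
    have hmin : pickMin s = s.min' hne := by simp [hpickMin, hne]
    have hmax : pickMax s = s.max' hne := by simp [hpickMax, hne]
    rw [hmin, hmax]
    exact ⟨s.min'_mem hne, s.max'_mem hne, (Finset.min'_lt_max'_of_card s hs).ne⟩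
  -- stability under transpositions inside column `0`
  have hEswap : ∀ {σ} {p q : Fin (D * m)}, p ∈ P₀ → q ∈ P₀ → E (Equiv.swap p q * σ) = E σ := by
    intro σ p q hp hq
    ext x
    simp only [hEmem]
    refine and_congr_right fun hx => ?_
    have hxp : x ≠ p := fun h => hx (by rw [h]; exact hP₀mem.1 hp)
    have hxq : x ≠ q := fun h => hx (by rw [h]; exact hP₀mem.1 hq)
    rw [mul_inv_rev, Equiv.swap_inv, Equiv.Perm.mul_apply, Equiv.swap_apply_of_ne_of_ne hxp hxq]
  have hQswap : ∀ {σ} {p q : Fin (D * m)}, p ∈ P₀ → q ∈ P₀ → Q (Equiv.swap p q * σ) = Q σ := by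
    intro σ p q hp hq
    simp only [hQ, hL, hU, hEswap hp hq]
  -- apply the swap criterion with `p σ = min Q σ`, `q σ = max Q σ`
  refine T.blockSymmetrizer_polytabloid_eq_zero_of_swap hN (fun σ => pickMin (Q σ))
    (fun σ => pickMax (Q σ)) ?_ ?_ ?_ ?_ ?_
  · intro σ hσ
    exact (hpick (hQcard hσ)).2.2
  · intro σ hσ
    obtain ⟨hp, hq, -⟩ := hpick (hQcard hσ)
    show (T.1 (pickMin (Q σ))).2 = (T.1 (pickMax (Q σ))).2
    rw [hP₀mem.1 (hQsub σ hp), hP₀mem.1 (hQsub σ hq)]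
  · intro σ hσ
    obtain ⟨hp, hq, -⟩ := hpick (hQcard hσ)
    show pickMin (Q (Equiv.swap (pickMin (Q σ)) (pickMax (Q σ)) * σ)) = pickMin (Q σ)
    rw [hQswap (hQsub σ hp) (hQsub σ hq)]
  · intro σ hσ
    obtain ⟨hp, hq, -⟩ := hpick (hQcard hσ)
    show pickMax (Q (Equiv.swap (pickMin (Q σ)) (pickMax (Q σ)) * σ)) = pickMax (Q σ)
    rw [hQswap (hQsub σ hp) (hQsub σ hq)]
  · -- the block swap
    intro σ hσ
    show ∃ β ∈ blockPerms D m, (T.rowWord hN ∘ ⇑σ⁻¹) ∘ ⇑β =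
      (T.rowWord hN ∘ ⇑σ⁻¹) ∘ ⇑(Equiv.swap (pickMin (Q σ)) (pickMax (Q σ)))
    obtain ⟨hp, hq, hpq⟩ := hpick (hQcard hσ)
    set p := pickMin (Q σ) with hp_def
    set q := pickMax (Q σ) with hq_def
    have hpP : p ∈ P₀ := hQsub σ hp
    have hqP : q ∈ P₀ := hQsub σ hq
    have hij : blockIdx D m p ≠ blockIdx D m q := hA p hpP q hqP hpq
    set v : Word N (D * m) := T.rowWord hN ∘ ⇑σ⁻¹ with hv
    have hvval : ∀ z, ((v z : Fin N) : ℕ) = (T.1 (σ⁻¹ z)).1 := fun z => rfl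
    set i := blockIdx D m p with hi
    set j := blockIdx D m q with hj
    set a₀ := (finProdFinEquiv.symm p).2 with ha₀
    set c₀ := (finProdFinEquiv.symm q).2 with hc₀
    have hpe : finProdFinEquiv (i, a₀) = p := finProdFinEquiv_blockIdx p
    have hqe : finProdFinEquiv (j, c₀) = q := finProdFinEquiv_blockIdx q
    have hsnd : ∀ (r : Fin D) (a : Fin m), (finProdFinEquiv.symm (finProdFinEquiv (r, a))).2 = a :=
      fun r a => by rw [Equiv.symm_apply_apply]
    -- it suffices to produce a permutation of the places matching the letters
    suffices H : ∃ π : Equiv.Perm (Fin m), π a₀ = c₀ ∧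
        ∀ a, a ≠ a₀ → v (finProdFinEquiv (j, π a)) = v (finProdFinEquiv (i, a)) by
      obtain ⟨π, hπ₀, hπ⟩ := H
      obtain ⟨β, hβ, hβeq⟩ := exists_mem_blockPerms_comp_eq_comp_swap hij a₀ π hπ
      refine ⟨β, hβ, ?_⟩
      rw [hβeq, hπ₀, hpe, hqe]
    -- letters in the block of an entry `r` of column `0`, off `r` and off the externals, are `0`
    have hzero : ∀ {r z : Fin (D * m)}, r ∈ P₀ → blockIdx D m z = blockIdx D m r → z ≠ r →
        z ∉ E σ → (T.1 (σ⁻¹ z)).1 = 0 :=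
      fun {r z} hr hb hzr hzE => hG2 (hG1 hr hzr hb) hzE
    by_cases hcase : 1 < (U σ).card
    · -- Case 1: `p`, `q` unlinked; their blocks are zero off `p`, `q`; `π = (a₀ c₀)`
      have hQU : Q σ = U σ := by simp only [hQ, if_pos hcase]
      have hpU : p ∈ U σ := hQU ▸ hp
      have hqU : q ∈ U σ := hQU ▸ hq
      have hunl : ∀ {r z : Fin (D * m)}, r ∈ U σ → blockIdx D m z = blockIdx D m r → z ≠ r →
          (T.1 (σ⁻¹ z)).1 = 0 := by
        intro r z hr hb hzr
        have hr' : r ∈ P₀.filter fun y => ¬ ∃ x ∈ E σ, blockIdx D m x = blockIdx D m y := hr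
        simp only [Finset.mem_filter, not_exists, not_and] at hr'
        exact hzero hr'.1 hb hzr fun hzE => hr'.2 z hzE hb
      refine ⟨Equiv.swap a₀ c₀, Equiv.swap_apply_left _ _, fun a ha => ?_⟩
      apply Fin.ext
      rw [hvval, hvval]
      have hza : finProdFinEquiv (i, a) ≠ p := fun h => ha (by
        have := congrArg (fun z => (finProdFinEquiv.symm z).2) h
        rwa [hsnd] at this)
      have hπa : Equiv.swap a₀ c₀ a ≠ c₀ := by
        rw [Ne, Equiv.apply_eq_iff_eq_symm_apply, Equiv.symm_swap, Equiv.swap_apply_right]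
        exact ha
      have hzb : finProdFinEquiv (j, Equiv.swap a₀ c₀ a) ≠ q := fun h => hπa (by
        have := congrArg (fun z => (finProdFinEquiv.symm z).2) h
        rwa [hsnd] at this)
      rw [hunl hqU (blockIdx_finProdFinEquiv _ _) hzb, hunl hpU (blockIdx_finProdFinEquiv _ _) hza]
    · -- Case 2: `p`, `q` linked, with unique externals `xp`, `xq` in their blocks (letter `1`)
      obtain ⟨-, hinj⟩ := hcase2 hσ hcase
      have hQL : Q σ = L σ := by simp only [hQ, if_neg hcase]
      have hpL' : p ∈ L σ := hQL ▸ hp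
      have hqL' : q ∈ L σ := hQL ▸ hq
      have hpL : p ∈ P₀.filter fun y => ∃ x ∈ E σ, blockIdx D m x = blockIdx D m y := hpL'
      have hqL : q ∈ P₀.filter fun y => ∃ x ∈ E σ, blockIdx D m x = blockIdx D m y := hqL'
      rw [Finset.mem_filter] at hpL hqL
      obtain ⟨-, xp, hxpE, hxpb⟩ := hpL
      obtain ⟨-, xq, hxqE, hxqb⟩ := hqL
      have huniq : ∀ {x z : Fin (D * m)}, x ∈ E σ → z ∈ E σ →
          blockIdx D m z = blockIdx D m x → z = x :=
        fun {x z} hx hz hb => hinj hz hx hb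
      set a₁ := (finProdFinEquiv.symm xp).2 with ha₁'
      set c₁ := (finProdFinEquiv.symm xq).2 with hc₁'
      have hxpe : finProdFinEquiv (i, a₁) = xp := by
        have := finProdFinEquiv_blockIdx (D := D) (m := m) xp
        rwa [hxpb] at this
      have hxqe : finProdFinEquiv (j, c₁) = xq := by
        have := finProdFinEquiv_blockIdx (D := D) (m := m) xq
        rwa [hxqb] at this
      have hxpP : (T.1 xp).2 ≠ 0 := (hEmem.1 hxpE).1
      have hxqP : (T.1 xq).2 ≠ 0 := (hEmem.1 hxqE).1
      have ha₁ : a₁ ≠ a₀ := by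
        intro h
        apply hxpP
        have : xp = p := by rw [← hxpe, ← hpe, h]
        rw [this]
        exact hP₀mem.1 hpP
      have hc₁ : c₁ ≠ c₀ := by
        intro h
        apply hxqP
        have : xq = q := by rw [← hxqe, ← hqe, h]
        rw [this]
        exact hP₀mem.1 hqP
      -- the permutation of the places: `a₀ ↦ c₀`, `a₁ ↦ c₁`
      set τ : Equiv.Perm (Fin m) := Equiv.swap a₀ c₀ with hτ
      have hτa₁ : τ a₁ ≠ c₀ := by
        rw [hτ, Ne, Equiv.apply_eq_iff_eq_symm_apply, Equiv.symm_swap, Equiv.swap_apply_right]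
        exact ha₁
      set π : Equiv.Perm (Fin m) := Equiv.swap (τ a₁) c₁ * τ with hπ
      have hπ₀ : π a₀ = c₀ := by
        rw [hπ, Equiv.Perm.mul_apply]
        have : τ a₀ = c₀ := by rw [hτ, Equiv.swap_apply_left]
        rw [this, Equiv.swap_apply_of_ne_of_ne hτa₁.symm hc₁.symm]
      have hπ₁ : π a₁ = c₁ := by
        rw [hπ, Equiv.Perm.mul_apply, Equiv.swap_apply_left]
      refine ⟨π, hπ₀, fun a ha => ?_⟩
      apply Fin.ext
      rw [hvval, hvval]
      by_cases ha1 : a = a₁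
      · rw [ha1, hπ₁, hxqe, hxpe, hE1 hσ xq hxqE, hE1 hσ xp hxpE]
      · have hπa0 : π a ≠ c₀ := by rw [← hπ₀]; exact fun h => ha (π.injective h)
        have hπa1 : π a ≠ c₁ := by rw [← hπ₁]; exact fun h => ha1 (π.injective h)
        have hz1 : finProdFinEquiv (i, a) ≠ p := fun h => ha (by
          have := congrArg (fun z => (finProdFinEquiv.symm z).2) h
          rwa [hsnd] at this)
        have hz1E : finProdFinEquiv (i, a) ∉ E σ := fun hzE => ha1 (by
          have h := huniq hxpE hzE (by rw [blockIdx_finProdFinEquiv, hxpb])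
          have := congrArg (fun z => (finProdFinEquiv.symm z).2) h
          rwa [hsnd] at this)
        have hz2 : finProdFinEquiv (j, π a) ≠ q := fun h => hπa0 (by
          have := congrArg (fun z => (finProdFinEquiv.symm z).2) h
          rwa [hsnd] at this)
        have hz2E : finProdFinEquiv (j, π a) ∉ E σ := fun hzE => hπa1 (by
          have h := huniq hxqE hzE (by rw [blockIdx_finProdFinEquiv, hxqb])
          have := congrArg (fun z => (finProdFinEquiv.symm z).2) h
          rwa [hsnd] at this)
        rw [hzero hqP (blockIdx_finProdFinEquiv _ _) hz2 hz2E,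
          hzero hpP (blockIdx_finProdFinEquiv _ _) hz1 hz1E]

/-! ### 4. Vanishing of plethysm highest-weight vectors of these shapes -/

/-- **No wreath-invariant highest-weight vectors of hook-like weight in the word model.** Under the
shape hypotheses of `blockSymmetrizer_polytabloid_eq_zero_of_shape` (`|Y| = D m`, fewer than `N`
rows), every `S_D ≀ S_m`-invariant highest-weight vector `x` of weight `λ = ydWeight N Y` of the
word model of `V^{⊗ Dm}` vanishes: `|S_D ≀ S_m| · x = Σ x = ∑_T a_T Σ e_T = 0` over the standard
fillings (BIP Prop. 3.3 in basis form), characteristic zero. That is, `HWV_λ(Sym^D Sym^m V) = 0`: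
the plethysm coefficient `a_λ(D[m])` vanishes.
[cite: IkenmeyerPanova2017, Thm. 1.7(a) (held: Thm. 7(a)); direct proof via BurgisserIkenmeyerPanovaJAMS2019 Prop. 3.3 and Lemma 4.3] -/
theorem eq_zero_of_mem_highestWeightSpace_wordRep_of_shape
    (hN : ∀ x ∈ Y.cells, x.1 < N) (hd : Y.cells.card = D * m)
    (h1 : ∀ c ∈ Y.cells, c.2 ≠ 0 → c.1 ≤ 1) (h2 : 2 ≤ Y.colLen 0)
    (h3 : Y.rowLen 1 ≤ Y.colLen 0) (h4 : Y.rowLen 1 ≤ 1 ∨ 3 ≤ Y.colLen 0)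
    {x : Word N (D * m) → k} (hx : x ∈ highestWeightSpace (wordRep k N (D * m)) (ydWeight N Y))
    (hinv : ∀ τ ∈ blockPerms D m, wordPerm k τ x = x) : x = 0 := by
  classical
  obtain ⟨a, ha⟩ := exists_sum_smul_polytabloid_eq hN hd hx
  have hS : (blockPermsFinset D m).card • x =
      ∑ T, a T • blockSymmetrizer k D m (T.polytabloid k hN) := by
    rw [← blockSymmetrizer_apply_of_forall_wordPerm_eq k hinv, ← ha, map_sum]
    simp_rw [map_smul]
  have h0 : (blockPermsFinset D m).card • x = 0 := by
    rw [hS]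
    exact Finset.sum_eq_zero fun T _ => by
      rw [T.blockSymmetrizer_polytabloid_eq_zero_of_shape hN hd h1 h2 h3 h4, smul_zero]
  rw [← Nat.cast_smul_eq_nsmul k] at h0
  exact (smul_eq_zero.mp h0).resolve_left (Nat.cast_ne_zero.mpr card_blockPermsFinset_pos.ne')

end Shapes

/-! ### 5. Back to `k[Sym^n]_d`: no highest-weight vectors of the dual hook-like weights -/

section Polynomials

open MvPolynomial

variable {k : Type*} [Field k] [CharZero k] {σ : Type*} [LinearOrder σ] [Fintype σ] {M : ℕ}
  {n d : ℕ}

/-- The number of rows of the Young diagram of a partition is its number of parts. [folklore] -/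
theorem colLen_zero_youngDiagram {D : ℕ} (lam : Nat.Partition D) :
    lam.youngDiagram.colLen 0 = lam.parts.card := by
  rw [← YoungDiagram.length_rowLens, Nat.Partition.rowLens_youngDiagram,
    Nat.Partition.length_sortedParts]

/-- **No highest-weight vectors of hook-like dual weight in `k[Sym^n (k^σ)]_d`** (plethysm
coefficients `a_λ(d[n]) = 0`). Let `ρ : Fin M ≃ σ` be order-reversing and `λ ⊢ d·n` a partition with
at most `M` parts, at least two parts (`h2`), all cells of its diagram outside column `0` in rows
`≤ 1` (`h1`), `λ₂ ≤ ℓ(λ)` (`h3`) and `λ₂ ≤ 1` or `ℓ(λ) ≥ 3` (`h4`) — the hooks `(L, 1^j)`, `j ≥ 1`,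
and the shapes `(L, 2, 1^j)`, `(L, 3, 1^j)`, `j ≥ 1`. Then every form `h` of degree `d` on
`Sym^n (k^σ)` which is a highest-weight vector of `coordRep` of weight `χ` with `-χ(ρ i) = λ_{i+1}`
(i.e. `χ = λ^*` read through `ρ`) is zero: its transported polarisation `wordOfForm ρ n d h` is an
`S_d ≀ S_n`-invariant highest-weight vector of weight `λ` of the word model
(`wordOfForm_mem_highestWeightSpace`, `wordPerm_wordOfForm`), hence zero
(`eq_zero_of_mem_highestWeightSpace_wordRep_of_shape`), and the polarisation is injective
(`eq_of_wordOfForm_eq`). Characteristic zero.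
[cite: IkenmeyerPanova2017, Thm. 1.7(a) (held: Thm. 7(a)); direct proof] -/
theorem eq_zero_of_mem_highestWeightSpace_coordRep_of_shape {ρ : Fin M ≃ σ} (hρ : StrictAnti ρ)
    (lam : Nat.Partition (d * n)) (hlam : lam.parts.card ≤ M)
    (h1 : ∀ c ∈ lam.youngDiagram.cells, c.2 ≠ 0 → c.1 ≤ 1) (h2 : 2 ≤ lam.parts.card)
    (h3 : lam.sortedParts.getD 1 0 ≤ lam.parts.card)
    (h4 : lam.sortedParts.getD 1 0 ≤ 1 ∨ 3 ≤ lam.parts.card)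
    {h : MvPolynomial (DegIdx σ n) k} (hh : h.IsHomogeneous d) {χ : Weight σ}
    (hχ : ∀ i, -χ (ρ i) = Weight.ofPartition M lam i)
    (hhw : h ∈ highestWeightSpace (coordRep σ k n) χ) : h = 0 := by
  classical
  set Y := lam.youngDiagram with hY
  have hN : ∀ x ∈ Y.cells, x.1 < M := fun x hx =>
    Literature.NumberTheory.DiophantineGeometry.fst_lt_of_mem_youngDiagram lam hlam hx
  have hd : Y.cells.card = d * n := lam.card_cells_youngDiagram
  have hcol : Y.colLen 0 = lam.parts.card := colLen_zero_youngDiagram lam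
  have hrow : Y.rowLen 1 = lam.sortedParts.getD 1 0 :=
    Literature.NumberTheory.DiophantineGeometry.rowLen_youngDiagram lam 1
  have hx : wordOfForm ρ n d h ∈ highestWeightSpace (wordRep k M (d * n)) (ydWeight M Y) := by
    have := wordOfForm_mem_highestWeightSpace hρ hh hhw
    rwa [show (fun i => -χ (ρ i)) = ydWeight M Y from by
      rw [hY, Literature.NumberTheory.DiophantineGeometry.ydWeight_youngDiagram]
      funext i
      exact hχ i] at this
  have hinv : ∀ τ ∈ blockPerms d n, wordPerm k τ (wordOfForm ρ n d h) = wordOfForm ρ n d h :=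
    fun τ hτ => wordPerm_wordOfForm ρ h hτ
  have hx0 : wordOfForm ρ n d h = 0 :=
    eq_zero_of_mem_highestWeightSpace_wordRep_of_shape hN hd h1 (by rw [hcol]; exact h2)
      (by rw [hrow, hcol]; exact h3) (by rw [hrow, hcol]; exact h4) hx hinv
  refine eq_of_wordOfForm_eq ρ hh (isHomogeneous_zero _ _ _) ?_
  rw [hx0]
  funext w
  rw [Pi.zero_apply, wordOfForm_apply, polarize, arrOf, coeff_zero, zero_div]

end Polynomials

end Literature.Computability.AlgebraicComplexity
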